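import Mathlib

/-!
# Stub `stub_tangencySets` (crux `LevelOneGL2Designs`, stmt-MatrixMultiplication-14080) —
wall-breaker axis 1/12 "Hermitian unital constructions" (gen 1, seat 2), part A: the polarity cap

A *Hermitian* construction of a strong representative system (SRS, tangency set) designates to each
point `P` the polar line of `P` under a `σ`-Hermitian form and keeps the absolute (isotropic) points:
two flags spoil each other iff the points are conjugate.  Over a field of order `q²` with `σ` the
Frobenius this is the classical unital, `q³ + 1` flags (`hermitian_srs`, part 2 of axis 10).  Over
the PRIME field `ZMod p` the only ring involution is the identity, so "Hermitian" means *symmetric*: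
the designation is an orthogonal polarity (possibly degenerate).  This file proves that then the
whole construction is conic-sized:

* `polarity_isotropic_card_le` — over any finite field `F` with `2 ≠ 0`, for any symmetric
  `3 × 3` matrix `B` (no non-degeneracy assumed), a family of vectors `v i ∈ F³` that are
  isotropic (`v i ⬝ B v i = 0`) and pairwise non-conjugate (`v i ⬝ B v j ≠ 0`, `i ≠ j`) has at most
  `|F| + 1` members.  Proof: normalise `u j = v j / β(v i₀, v j)`; the linear coordinate
  `ψ j = (v i₀ ⨯₃ v i₁) ⬝ u j` is injective on `j ≠ i₀`, because `ψ j = ψ k` forces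
  `u j − u k ∈ F·v i₀` (a vector dot-orthogonal to `B v i₀` and to `v i₀ ⨯₃ v i₁` is a multiple of
  `(B v i₀) ⨯₃ (v i₀ ⨯₃ v i₁) = β(v i₁, v i₀)·v i₀`), and then isotropy of `u j = u k + a·v i₀`
  reads `2a = 0`.
* `srs_card_le_of_polarity` — consequently an `S` in the stub's format over `ZMod p`, `p` odd,
  whose incidences `x_f ⬝ y_{f'} = 1` on `S × S` are those of a symmetric bilinear form in the
  homogenised points `(x_f, 1)` ("carried by a polarity"), has `|S| ≤ p + 1` — against the
  `c·p^{3/2}` the stub asks for.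
* `parabola_srs_polarity` — the cap is attained up to two: the `p − 1` tangent flags of the
  parabola `y = x²` are carried by the polarity of the conic `x² = yz`.

So on this axis the prime field is not "missing a clever Hermitian curve": every symmetric
designation is a conic (`≤ p + 1`), every Frobenius-twisted one needs a square field.  Mathlib only
(`crossProduct`, `cross_cross_eq_smul_sub_smul`, `crossProduct_ne_zero_iff_linearIndependent`);
no new definitions.
-/

set_option linter.dupNamespace false

namespace Summit.MatrixMultiplication.MatrixMultiplication.Theorems.LevelOneGL2Designs.HermitianUnital

open Finset Matrix

section PolarityCap

variable {F : Type*} [Field F]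

/-- A symmetric matrix gives a symmetric bilinear form `x ⬝ B y = y ⬝ B x`. [folklore] -/
theorem dotProduct_mulVec_comm_of_isSymm {B : Matrix (Fin 3) (Fin 3) F} (hB : B.IsSymm)
    (x y : Fin 3 → F) : x ⬝ᵥ (B *ᵥ y) = y ⬝ᵥ (B *ᵥ x) := by
  rw [dotProduct_mulVec, ← mulVec_transpose, hB.eq, dotProduct_comm]

/-- **Polarity cap.**  Over a finite field `F` of characteristic `≠ 2`, let `B` be ANY symmetric
`3 × 3` matrix and `v : ι → F³` a family of `B`-isotropic, pairwise non-`B`-conjugate vectors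
(`v i ⬝ B v i = 0`, `v i ⬝ B v j ≠ 0` for `i ≠ j`).  Then `|ι| ≤ |F| + 1`: the absolute points of an
orthogonal polarity that pairwise spoil nobody are at most a conic's worth.  (For `B` non-degenerate
this is "a conic has `q + 1` points"; the proof below is uniform in the rank of `B`.)
[folklore; elementary linear algebra in `F³`] -/
theorem polarity_isotropic_card_le [Fintype F] (h2 : (2 : F) ≠ 0)
    {B : Matrix (Fin 3) (Fin 3) F} (hB : B.IsSymm)
    {ι : Type*} [Fintype ι] [DecidableEq ι] (v : ι → Fin 3 → F)
    (h0 : ∀ i, v i ⬝ᵥ (B *ᵥ v i) = 0) (h1 : ∀ i j, i ≠ j → v i ⬝ᵥ (B *ᵥ v j) ≠ 0) :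
    Fintype.card ι ≤ Fintype.card F + 1 := by
  classical
  by_cases hι : Fintype.card ι ≤ 1
  · omega
  push Not at hι
  obtain ⟨i₀, i₁, h01⟩ := Fintype.exists_pair_of_one_lt_card hι
  -- the symmetric form, the normalised vectors, the linear coordinate
  have hsymm : ∀ x y : Fin 3 → F, x ⬝ᵥ (B *ᵥ y) = y ⬝ᵥ (B *ᵥ x) :=
    dotProduct_mulVec_comm_of_isSymm hB
  set v₀ := v i₀ with hv₀
  set m : Fin 3 → F := B *ᵥ v₀ with hm
  set n : Fin 3 → F := v₀ ⨯₃ v i₁ with hn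
  let c : ι → F := fun j => (v₀ ⬝ᵥ (B *ᵥ v j))⁻¹
  let u : ι → Fin 3 → F := fun j => c j • v j
  let ψ : ι → F := fun j => n ⬝ᵥ u j
  have hv₀0 : v₀ ≠ 0 := by
    intro h
    apply h1 i₀ i₁ h01
    rw [← hv₀, h, zero_dotProduct]
  have hb : v i₁ ⬝ᵥ (B *ᵥ v₀) ≠ 0 := h1 i₁ i₀ (Ne.symm h01)
  -- `m ⨯₃ n = β(v i₁, v i₀) • v₀`
  have hmn : m ⨯₃ n = (v i₁ ⬝ᵥ (B *ᵥ v₀)) • v₀ := by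
    rw [hn, cross_cross_eq_smul_sub_smul', hm, dotProduct_comm (B *ᵥ v₀) (v i₁)]
    have : v₀ ⬝ᵥ (B *ᵥ v₀) = 0 := h0 i₀
    rw [this, zero_smul, sub_zero]
  -- normalisation facts for `j ≠ i₀`
  have hc : ∀ j, j ≠ i₀ → c j * (v₀ ⬝ᵥ (B *ᵥ v j)) = 1 := fun j hj =>
    inv_mul_cancel₀ (h1 i₀ j (Ne.symm hj))
  have hc0 : ∀ j, j ≠ i₀ → c j ≠ 0 := fun j hj => inv_ne_zero (h1 i₀ j (Ne.symm hj))
  have hu1 : ∀ j, j ≠ i₀ → v₀ ⬝ᵥ (B *ᵥ u j) = 1 := by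
    intro j hj
    simp only [u, mulVec_smul, dotProduct_smul, smul_eq_mul, hc j hj]
  have hu1' : ∀ j, j ≠ i₀ → u j ⬝ᵥ (B *ᵥ v₀) = 1 := fun j hj => by rw [hsymm, hu1 j hj]
  have hm1 : ∀ j, j ≠ i₀ → m ⬝ᵥ u j = 1 := fun j hj => by
    rw [hm, dotProduct_comm, hu1' j hj]
  have hu0 : ∀ j, u j ⬝ᵥ (B *ᵥ u j) = 0 := by
    intro j
    simp only [u, mulVec_smul, dotProduct_smul, smul_dotProduct, smul_eq_mul, h0 j, mul_zero]
  -- injectivity of `ψ` on `j ≠ i₀`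
  have hinj : Set.InjOn ψ ↑(univ.erase i₀ : Finset ι) := by
    intro j hj k hk hjk
    simp only [coe_erase, coe_univ, Set.mem_sdiff, Set.mem_univ, Set.mem_singleton_iff,
      true_and] at hj hk
    set d : Fin 3 → F := u j - u k with hd
    have hnd : n ⬝ᵥ d = 0 := by
      rw [hd, dotProduct_sub]
      exact sub_eq_zero.mpr hjk
    have hmd : m ⬝ᵥ d = 0 := by
      rw [hd, dotProduct_sub, hm1 j hj, hm1 k hk, sub_self]
    -- `d` is a multiple of `v₀`
    have hcross : v₀ ⨯₃ d = 0 := by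
      have h3 : (m ⨯₃ n) ⨯₃ d = 0 := by
        rw [cross_cross_eq_smul_sub_smul, hmd, hnd, zero_smul, zero_smul, sub_zero]
      rw [hmn, LinearMap.map_smul₂, smul_eq_zero] at h3
      exact h3.resolve_left hb
    have hdep : ¬ LinearIndependent F ![v₀, d] := by
      rw [← crossProduct_ne_zero_iff_linearIndependent]
      exact fun h => h hcross
    rw [LinearIndependent.pair_iff' hv₀0] at hdep
    push Not at hdep
    obtain ⟨a, ha⟩ := hdep
    -- isotropy of `u j = u k + a • v₀` forces `2a = 0`
    have huj : u j = u k + a • v₀ := by rw [ha, hd]; abel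
    have hexp : (u k + a • v₀) ⬝ᵥ (B *ᵥ (u k + a • v₀)) =
        u k ⬝ᵥ (B *ᵥ u k) + a * (u k ⬝ᵥ (B *ᵥ v₀)) + a * (v₀ ⬝ᵥ (B *ᵥ u k)) +
          a * a * (v₀ ⬝ᵥ (B *ᵥ v₀)) := by
      simp only [mulVec_add, mulVec_smul, dotProduct_add, add_dotProduct, dotProduct_smul,
        smul_dotProduct, smul_eq_mul]
      ring
    have h00 : v₀ ⬝ᵥ (B *ᵥ v₀) = 0 := h0 i₀
    have hiso := hu0 j
    rw [huj, hexp, hu0 k, hu1 k hk, hu1' k hk, h00] at hiso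
    have ha0 : a = 0 := by
      have : a * 2 = 0 := by linear_combination hiso
      exact (mul_eq_zero.mp this).resolve_right h2
    rw [ha0, zero_smul, add_zero] at huj
    -- `u j = u k` with `j ≠ k` would make `v j`, `v k` conjugate-free yet proportional
    by_contra hne
    have hvj : v j = (c j)⁻¹ • u k := by
      rw [← huj]
      simp only [u, smul_smul, inv_mul_cancel₀ (hc0 j hj), one_smul]
    apply h1 j k hne
    rw [hvj]
    simp only [u, smul_smul, smul_dotProduct, smul_eq_mul, h0 k, mul_zero]
  have hmaps : Set.MapsTo ψ ↑(univ.erase i₀ : Finset ι) ↑(univ : Finset F) := fun j _ => by simp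
  have hle := card_le_card_of_injOn ψ hmaps hinj
  rw [card_erase_of_mem (mem_univ _), card_univ, card_univ] at hle
  omega

end PolarityCap

section Stub

variable (p : ℕ) [hp : Fact p.Prime]

/-- **Hermitian-over-the-prime-field = conic-sized.**  Let `S ⊆ 𝔽_p² × 𝔽_p²` be a design in the
stub's format (`x_f ⬝ y_{f'} = 1 ↔ f = f'`), `p` an odd prime, and suppose it is *carried by a
polarity*: for some symmetric `B ∈ 𝔽_p^{3×3}` the incidences on `S × S` are
`x_f ⬝ y_{f'} = 1 ↔ (x_f,1) ⬝ B (x_{f'},1) = 0` (the line of `f'` agrees, on the points of `S`,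
with the polar line of the point of `f'`; `B` may be degenerate).  Then `|S| ≤ p + 1`.
This is the prime-field shadow of the unital: with the Frobenius-Hermitian form of `𝔽_{q²}` the
same recipe gives `q³ − 1` flags (`hermitian_srs`).  [this file, from `polarity_isotropic_card_le`] -/
theorem srs_card_le_of_polarity (hp2 : p ≠ 2)
    (S : Finset ((Fin 2 → ZMod p) × (Fin 2 → ZMod p)))
    (hS : ∀ f ∈ S, ∀ f' ∈ S, (f.1 ⬝ᵥ f'.2 = 1 ↔ f = f'))
    (B : Matrix (Fin 3) (Fin 3) (ZMod p)) (hB : B.IsSymm)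
    (hpol : ∀ f ∈ S, ∀ f' ∈ S,
      (f.1 ⬝ᵥ f'.2 = 1 ↔ ![f.1 0, f.1 1, 1] ⬝ᵥ (B *ᵥ ![f'.1 0, f'.1 1, 1]) = 0)) :
    S.card ≤ p + 1 := by
  classical
  let v : S → Fin 3 → ZMod p := fun f => ![f.1.1 0, f.1.1 1, 1]
  have h0 : ∀ i, v i ⬝ᵥ (B *ᵥ v i) = 0 := fun i =>
    (hpol _ i.2 _ i.2).mp ((hS _ i.2 _ i.2).mpr rfl)
  have h1 : ∀ i j, i ≠ j → v i ⬝ᵥ (B *ᵥ v j) ≠ 0 := by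
    intro i j hij h
    exact hij (Subtype.ext ((hS _ i.2 _ j.2).mp ((hpol _ i.2 _ j.2).mpr h)))
  -- `2 ≠ 0` in `ZMod p` for the odd prime `p`
  have h2 : (2 : ZMod p) ≠ 0 := by
    intro h
    have h' : ((2 : ℕ) : ZMod p) = 0 := by exact_mod_cast h
    rw [ZMod.natCast_eq_zero_iff] at h'
    rcases Nat.prime_two.eq_one_or_self_of_dvd p h' with h1 | h1
    · exact hp.out.ne_one h1
    · exact hp2 h1
  have h := polarity_isotropic_card_le h2 hB v h0 h1
  rwa [Fintype.card_coe, ZMod.card] at h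

/-- **The cap is attained up to two.**  For every odd prime `p` the `p − 1` tangent flags
`((t, t²), (2/t, −1/t²))`, `t ≠ 0`, of the parabola `y = x²` form a design in the stub's format that
IS carried by a polarity — the symmetric matrix `B = [[2,0,0],[0,0,−1],[0,−1,0]]` of the conic
`2(x² − yz) = 0`: `(s,s²,1) ⬝ B (t,t²,1) = −(s − t)²`.  So `srs_card_le_of_polarity` is sharp up to
the two flags lost to the affine chart.  [this file; the flags are those of
`TangencyRandAlg.parabola_srs`] -/
theorem parabola_srs_polarity :
    ∃ (S : Finset ((Fin 2 → ZMod p) × (Fin 2 → ZMod p))) (B : Matrix (Fin 3) (Fin 3) (ZMod p)),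
      S.card = p - 1 ∧ B.IsSymm ∧
      (∀ f ∈ S, ∀ f' ∈ S, (f.1 ⬝ᵥ f'.2 = 1 ↔ f = f')) ∧
      (∀ f ∈ S, ∀ f' ∈ S,
        (f.1 ⬝ᵥ f'.2 = 1 ↔ ![f.1 0, f.1 1, 1] ⬝ᵥ (B *ᵥ ![f'.1 0, f'.1 1, 1]) = 0)) := by
  classical
  let φ : ZMod p → (Fin 2 → ZMod p) × (Fin 2 → ZMod p) :=
    fun t => (![t, t ^ 2], ![2 / t, -1 / t ^ 2])
  have hφ : Function.Injective φ := by
    intro t t' h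
    have := congrArg (fun f : (Fin 2 → ZMod p) × (Fin 2 → ZMod p) => f.1 0) h
    simpa [φ] using this
  let B : Matrix (Fin 3) (Fin 3) (ZMod p) := !![2, 0, 0; 0, 0, -1; 0, -1, 0]
  have hB : B.IsSymm := by
    ext i j; fin_cases i <;> fin_cases j <;> rfl
  -- incidence and polarity on parameters
  have key : ∀ t t' : ZMod p, t ≠ 0 → t' ≠ 0 →
      ((φ t).1 ⬝ᵥ (φ t').2 = 1 ↔ t = t') := by
    intro t t' ht ht'
    simp only [φ, vec2_dotProduct, cons_val_zero, cons_val_one]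
    constructor
    · intro h
      have h2 : 2 * t * t' - t ^ 2 = t' ^ 2 := by
        field_simp at h
        linear_combination h
      have h3 : (t - t') ^ 2 = 0 := by linear_combination -h2
      exact sub_eq_zero.mp (pow_eq_zero_iff two_ne_zero |>.mp h3)
    · rintro rfl
      field_simp
      ring
  have keyB : ∀ t t' : ZMod p,
      (![(φ t).1 0, (φ t).1 1, 1] ⬝ᵥ (B *ᵥ ![(φ t').1 0, (φ t').1 1, 1]) = 0 ↔ t = t') := by
    intro t t'
    have hval : ![(φ t).1 0, (φ t).1 1, 1] ⬝ᵥ (B *ᵥ ![(φ t').1 0, (φ t').1 1, 1]) =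
        -(t - t') ^ 2 := by
      simp [φ, B, mulVec, dotProduct, Fin.sum_univ_three]
      ring
    rw [hval, neg_eq_zero, pow_eq_zero_iff two_ne_zero, sub_eq_zero]
  refine ⟨(univ.filter fun t : ZMod p => t ≠ 0).image φ, B, ?_, hB, ?_, ?_⟩
  · rw [card_image_of_injective _ hφ, filter_ne' univ (0 : ZMod p), card_erase_of_mem (mem_univ _),
      card_univ, ZMod.card]
  · intro f hf f' hf'
    simp only [mem_image, mem_filter, mem_univ, true_and] at hf hf'
    obtain ⟨t, ht, rfl⟩ := hf
    obtain ⟨t', ht', rfl⟩ := hf'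
    rw [key t t' ht ht']
    exact ⟨fun h => by rw [h], fun h => hφ h⟩
  · intro f hf f' hf'
    simp only [mem_image, mem_filter, mem_univ, true_and] at hf hf'
    obtain ⟨t, ht, rfl⟩ := hf
    obtain ⟨t', ht', rfl⟩ := hf'
    rw [key t t' ht ht', keyB t t']

end Stub

end Summit.MatrixMultiplication.MatrixMultiplication.Theorems.LevelOneGL2Designs.HermitianUnital
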